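import Summits.ResolutionOfSingularities.ResolutionOfSingularities.Theorems.PurelyInseparableDim4WinCertLeaf
import HarnessLib
import HarnessLib.Audit.Tags

/-!
# Purely inseparable fourfolds — FCert v3 («LCert»): the ORACLE-PARAMETRISED row checker `lwinCertBL p q leafOK` and its
# SOUNDNESS over EVERY field of characteristic `p` (in-scope game, `q = p`), for any leaf oracle satisfying `LeafSound`
# [OURS · counted 0 · a certificate format for OUR frame v4, not about resolution]

Census cell «res-dim4-pi» (D-0157 DOOR 2), desk WORDS #111 (b) / #113 (d); seat res-rescue-typ-3 g9.  Sequel of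
`…WinCertLeaf` (`LWit`, `ILeaf`, `lcoverOKL`, `rational_or_onFlat_or_onILeaf`); the proof skeleton is this seat's
`…WinCertSubstSound` (itself following res-rescue-typ-3 g8's `…WinCertFlatSound`) with the leaf case abstracted:

* `LRow k C = IRow k × List (LWit k) × List (Flat k) × List (ILeaf k C)`, `LCert k C = List (LRow k C)`.
* A LEAF ORACLE is any `leafOK : SData 4 k → Finset (Fin 4) → ILeaf k C → Bool`; `LeafSound p leafOK` says: whenever
  `leafOK s S ℓ = true`, then over every field `K` of characteristic `p`, along every `f : ZMod p →+* K`, every centre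
  point `b` of chart `ℓ.j` ON the leaf gives a child `CentreBlowup.step p S ℓ.j b (s ⊗ K)` OUT of coordinate scope.
  The oracles for the landed kinds (p-8's `substBlindB`, `normLeafB`) and their `LeafSound` proofs are the sequel
  `…WinCertLeafKinds`; a new kind (Laurent, constants, …) = a new oracle + one `LeafSound` theorem, no new checker.
* `lrowOKL p q leafOK rest row` (blind row | origin not `q`-fold | MOVE row: permissible, replies harmless-or-flat-or-leaf
  `lrepliesOKB`, flats' base children later `lflatsOKB`, leaves in charts of the centre and passing the oracle
  `lleavesOKB`, charts covered `lcoversOKB`), `lwinCertBL`, block form `lwinCertBL2` / `lwinCertBL_append_of`.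
* **`forall_inScopeStateWins_of_lwinCertBL (hs : LeafSound p leafOK) (h : lwinCertBL p p leafOK T = true)`**: every
  row state `⊗ K` is IN-SCOPE ESCAPABLE over every field `K` of characteristic `p`.
Nothing here proves resolution of singularities in dimension ≥ 4 / characteristic `p`; F4-C(2,2) stays OPEN; the column
this feeds certifies `InScopeStateWins` on listed roots only.  Counted 0; AI work, weaker than expert review.
bears_on: LADDER-RESOLUTION:D157-DOOR2 (res-dim4-pi · F4-C ∀K column · FCert v3 soundness).
Supports stmt-ResolutionOfSingularities-16155 (helper).
-/

set_option linter.dupNamespace false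

noncomputable section
open MvPolynomial Finset
open scoped BigOperators
namespace Summit.ResolutionOfSingularities.ResolutionOfSingularities.Theorems.PIDim4

namespace WinCertLeaf

open Literature.AlgebraicGeometry.Resolution
open Literature.AlgebraicGeometry.Resolution.CentreBlowup
open StepKit WinCertSound InScopeWinCert ScopeCover ScopeBlind WinCertAllFields FlatAbsorb WinCertFlat WinCertSubst

/-! ## 0. Rows and the kernel-reducible checker -/

section Checker

variable {k : Type} [Field k] [DecidableEq k]

variable {C : Type}

/-- A row of FCert v3: `(presented state, A's centre, blindness certificate?)`, cover witnesses, flats, implicit leaves.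
[folklore] -/
abbrev LRow (k : Type) (C : Type) : Type := IRow k × List (LWit k) × List (Flat k) × List (ILeaf k C)

/-- A certificate: rows, children LATER in the list. [folklore] -/
abbrev LCert (k : Type) (C : Type) : Type := List (LRow k C)

/-- A `.mono` blindness certificate of the row passes. [folklore] -/
def lmonoBlindOK (q : ℕ) (row : LRow k C) : Bool :=
  match row.1.2.2 with
  | some (.mono c w α₀ a) => blindB q row.1.1 c w α₀ a
  | _ => false

variable [Fintype k]

/-- **The base child of a flat is certified later by a MOVE avoiding the flat's free coordinates.** [folklore] -/
def lbaseOK (q : ℕ) (rest : LCert k C) (c : SData 4 k) (U : Finset (Fin 4)) : Bool :=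
  rest.any fun r : LRow k C => c.equivB r.1.1 && decide (r.1.2.2 = none) && permB q Finset.univ r.1.1.L &&
    permB q r.1.2.1 r.1.1.L && decide (Disjoint r.1.2.1 U)

/-- **Every `k`-rational reply is harmless, or on a flat, or on a leaf.** [folklore] -/
def lrepliesOKB (q : ℕ) (rest : LCert k C) (s : SData 4 k) (S : Finset (Fin 4)) (flats : List (Flat k))
    (leaves : List (ILeaf k C)) : Bool :=
  decide (∀ j ∈ S, ∀ b : Fin 4 → k, b j = 0 →
    ireplyOK q (rest.map fun r : LRow k C => r.1) s S j b = true ∨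
      (∃ φ ∈ flats, φ.j = j ∧ onFlatB φ b = true) ∨ (∃ ℓ ∈ leaves, ℓ.j = j ∧ onLeafBL ℓ b = true))

/-- **Every flat sits in a chart of the centre, through a centre point, with its base child certified later.**
[folklore] -/
def lflatsOKB (q : ℕ) (rest : LCert k C) (s : SData 4 k) (S : Finset (Fin 4)) (flats : List (Flat k)) : Bool :=
  decide (∀ φ ∈ flats, φ.j ∈ S ∧ φ.b0 φ.j = 0 ∧ lbaseOK q rest (stepD q S φ.j φ.b0 s) φ.U = true)

/-- **Every leaf sits in a chart of the centre and passes the leaf oracle on that chart.** [folklore] -/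
def lleavesOKB (leafOK : SData 4 k → Finset (Fin 4) → ILeaf k C → Bool) (s : SData 4 k) (S : Finset (Fin 4))
    (leaves : List (ILeaf k C)) : Bool :=
  decide (∀ ℓ ∈ leaves, ℓ.j ∈ S ∧ leafOK s S ℓ = true)

/-- **Every chart of the centre is covered.** [folklore] -/
def lcoversOKB (p q : ℕ) (s : SData 4 k) (S : Finset (Fin 4)) (wits : List (LWit k)) (flats : List (Flat k))
    (leaves : List (ILeaf k C)) : Bool :=
  decide (∀ j ∈ S, lcoverOKL p q s S j wits flats leaves = true)

/-- **The row check** of FCert v3, for a leaf oracle `leafOK`. [folklore] -/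
def lrowOKL (p q : ℕ) (leafOK : SData 4 k → Finset (Fin 4) → ILeaf k C → Bool) (rest : LCert k C)
    (row : LRow k C) : Bool :=
  lmonoBlindOK q row || !(permB q Finset.univ row.1.1.L) ||
    (permB q row.1.2.1 row.1.1.L &&
      lrepliesOKB q rest row.1.1 row.1.2.1 row.2.2.1 row.2.2.2 &&
      lflatsOKB q rest row.1.1 row.1.2.1 row.2.2.1 &&
      lleavesOKB leafOK row.1.1 row.1.2.1 row.2.2.2 &&
      lcoversOKB p q row.1.1 row.1.2.1 row.2.1 row.2.2.1 row.2.2.2)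

/-- **The checker** of FCert v3. [folklore] -/
def lwinCertBL (p q : ℕ) (leafOK : SData 4 k → Finset (Fin 4) → ILeaf k C → Bool) : LCert k C → Bool
  | [] => true
  | row :: rest => lrowOKL p q leafOK rest row && lwinCertBL p q leafOK rest

/-- **Block form of the checker**: the rows of `A` are checked against their tails inside `A ++ B`; `B` itself is not
checked. [folklore] -/
def lwinCertBL2 (p q : ℕ) (leafOK : SData 4 k → Finset (Fin 4) → ILeaf k C → Bool) : LCert k C → LCert k C → Bool
  | [], _ => true
  | row :: A, B => lrowOKL p q leafOK (A ++ B) row && lwinCertBL2 p q leafOK A B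

/-- `lwinCertBL (A ++ B)` splits into the block check of `A` over `B` and the check of `B`. [folklore] -/
theorem lwinCertBL_append (p q : ℕ) (leafOK : SData 4 k → Finset (Fin 4) → ILeaf k C → Bool) : ∀ A B : LCert k C,
    lwinCertBL p q leafOK (A ++ B) = (lwinCertBL2 p q leafOK A B && lwinCertBL p q leafOK B)
  | [], B => by simp [lwinCertBL2]
  | row :: A, B => by
    rw [List.cons_append, show lwinCertBL p q leafOK (row :: (A ++ B)) =
      (lrowOKL p q leafOK (A ++ B) row && lwinCertBL p q leafOK (A ++ B)) from rfl,
      show lwinCertBL2 p q leafOK (row :: A) B = (lrowOKL p q leafOK (A ++ B) row && lwinCertBL2 p q leafOK A B)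
      from rfl, lwinCertBL_append p q leafOK A B, Bool.and_assoc]

/-- Assembling a certificate check from a block check and the check of the tail. [folklore] -/
theorem lwinCertBL_append_of (p q : ℕ) (leafOK : SData 4 k → Finset (Fin 4) → ILeaf k C → Bool) {A B : LCert k C}
    (hA : lwinCertBL2 p q leafOK A B = true) (hB : lwinCertBL p q leafOK B = true) :
    lwinCertBL p q leafOK (A ++ B) = true := by
  rw [lwinCertBL_append, hA, hB, Bool.and_self]

omit [Fintype k] in
/-- Soundness of `lbaseOK`. [folklore] -/
theorem exists_of_lbaseOK {q : ℕ} {rest : LCert k C} {c : SData 4 k} {U : Finset (Fin 4)}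
    (h : lbaseOK q rest c U = true) :
    ∃ r ∈ rest, c.toState = r.1.1.toState ∧ r.1.2.2 = none ∧ permB q Finset.univ r.1.1.L = true ∧
      permB q r.1.2.1 r.1.1.L = true ∧ Disjoint r.1.2.1 U := by
  unfold lbaseOK at h
  obtain ⟨r, hr, hrc⟩ := List.any_eq_true.mp h
  simp only [Bool.and_eq_true, decide_eq_true_eq] at hrc
  obtain ⟨⟨⟨⟨he, hn⟩, hu⟩, hp⟩, hd⟩ := hrc
  exact ⟨r, hr, (toState_eq_iff c r.1.1).mpr he, hn, hu, hp, hd⟩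

end Checker

/-! ## 1. Leaf oracles and the inductive invariant -/

variable {C : Type}

/-- **A SOUND LEAF ORACLE**: whenever it accepts a leaf `ℓ` for the presented state `s` and centre `S`, then over every
field `K` of characteristic `p`, along every `f : ZMod p →+* K`, every centre point `b` of chart `ℓ.j` lying ON the leaf
gives a child OUT of coordinate scope. [folklore] -/
def LeafSound (p : ℕ) [Fact p.Prime] (leafOK : SData 4 (ZMod p) → Finset (Fin 4) → ILeaf (ZMod p) C → Bool) : Prop :=
  ∀ (s : SData 4 (ZMod p)) (S : Finset (Fin 4)) (ℓ : ILeaf (ZMod p) C), leafOK s S ℓ = true →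
    ∀ (K : Type) [Field K] [CharP K p] [DecidableEq K] (f : ZMod p →+* K) (b : Fin 4 → K), b ℓ.j = 0 →
      OnLeaf f ℓ b →
        ¬ InCoordinateScope p
          (CentreBlowup.step p S ℓ.j b
            (⟨MvPolynomial.map f s.toState.F, s.toState.r, s.toState.exc⟩ : State K)).F

/-- The state of a row, base-changed along `f`. [folklore] -/
def lrowState {p : ℕ} [Fact p.Prime] {K : Type} [Field K] (f : ZMod p →+* K) (row : LRow (ZMod p) C) : State K :=
  ⟨MvPolynomial.map f row.1.1.toState.F, row.1.1.toState.r, row.1.1.toState.exc⟩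

/-- **A good row** over `K`: its state is in-scope escapable, and — if it is a non-blind `p`-fold row — its centre is
permissible and every `K`-edge through its centre leads to an in-scope escapable state. [folklore] -/
def LRowGood {p : ℕ} [Fact p.Prime] {K : Type} [Field K] [DecidableEq K] (f : ZMod p →+* K)
    (row : LRow (ZMod p) C) : Prop :=
  InScopeStateWins p (lrowState f row) ∧
    (row.1.2.2 = none → permB p Finset.univ row.1.1.L = true →
      IsPermissibleCentre p row.1.2.1 (lrowState f row).F ∧
        ∀ t, Edge p row.1.2.1 (lrowState f row) t → InScopeStateWins p t)

/-! ## 2. Soundness of one row -/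

/-- The edges through the centre of a MOVE row all lead to in-scope escapable states. [folklore] -/
theorem ledges_of_move {p : ℕ} [Fact p.Prime] {K : Type} [Field K] [CharP K p] [DecidableEq K]
    (f : ZMod p →+* K) {leafOK : SData 4 (ZMod p) → Finset (Fin 4) → ILeaf (ZMod p) C → Bool}
    (hs : LeafSound p leafOK) {rest : LCert (ZMod p) C} (hrest : ∀ r ∈ rest, LRowGood f r) {row : LRow (ZMod p) C}
    (hall : lrepliesOKB p rest row.1.1 row.1.2.1 row.2.2.1 row.2.2.2 = true)
    (hflats : lflatsOKB p rest row.1.1 row.1.2.1 row.2.2.1 = true)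
    (hleaves : lleavesOKB leafOK row.1.1 row.1.2.1 row.2.2.2 = true)
    (hcov : lcoversOKB p p row.1.1 row.1.2.1 row.2.1 row.2.2.1 row.2.2.2 = true) :
    ∀ t, Edge p row.1.2.1 (lrowState f row) t → InScopeStateWins p t := by
  classical
  unfold lrepliesOKB at hall
  unfold lflatsOKB at hflats
  unfold lleavesOKB at hleaves
  unfold lcoversOKB at hcov
  have hall' := of_decide_eq_true hall
  have hflats' := of_decide_eq_true hflats
  have hleaves' := of_decide_eq_true hleaves
  have hcov' := of_decide_eq_true hcov
  -- a flat of chart `j` absorbs every `K`-point on it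
  have hflat : ∀ (j : Fin 4) (φ : Flat (ZMod p)), φ ∈ row.2.2.1 → φ.j = j → ∀ b : Fin 4 → K, OnFlat f φ b →
      InScopeStateWins p (step p row.1.2.1 j b (lrowState f row)) := by
    intro j φ hφ hφj b hb
    obtain ⟨-, -, hbase⟩ := hflats' φ hφ
    obtain ⟨r, hr, hrc, hnone, huniv, hpermr, hdisj⟩ := exists_of_lbaseOK hbase
    obtain ⟨v, hv, rfl⟩ := exists_add_of_onFlat f hb
    have hgood := (hrest r hr).2 hnone huniv
    have hstep : step p row.1.2.1 j (f ∘ φ.b0) (lrowState f row) =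
        ⟨MvPolynomial.map f (stepD p row.1.2.1 φ.j φ.b0 row.1.1).toState.F,
          (stepD p row.1.2.1 φ.j φ.b0 row.1.1).toState.r, (stepD p row.1.2.1 φ.j φ.b0 row.1.1).toState.exc⟩ := by
      rw [lrowState, ← hφj, BaseChange.step_map f p row.1.2.1 φ.j φ.b0 row.1.1.toState, step_toState]
    have hF : (step p row.1.2.1 j (f ∘ φ.b0) (lrowState f row)).F = (lrowState f r).F := by
      rw [hstep, lrowState, hrc]
    refine inScopeStateWins_step_add_of_move (S' := r.1.2.1) (fun i hi => hv i ?_) ?_ ?_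
    · exact fun hiU => (Finset.disjoint_left.mp hdisj) hi hiU
    · rw [hF]; exact hgood.1
    · intro t ht
      obtain ⟨t', ht', hFt⟩ := edge_congr hF ht
      exact inScopeStateWins_congr (hgood.2 t' ht') t hFt
  -- a leaf of chart `j` gives a blind child at every `K`-point on it
  have hleaf : ∀ (j : Fin 4) (ℓ : ILeaf (ZMod p) C), ℓ ∈ row.2.2.2 → ℓ.j = j → ∀ b : Fin 4 → K, b j = 0 →
      OnLeaf f ℓ b → InScopeStateWins p (step p row.1.2.1 j b (lrowState f row)) := by
    intro j ℓ hℓ hℓj b hbj hb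
    obtain ⟨-, hok⟩ := hleaves' ℓ hℓ
    refine inScopeStateWins_of_not_inCoordinateScope ?_
    rw [← hℓj]
    exact hs row.1.1 row.1.2.1 ℓ hok K f b (by rw [hℓj]; exact hbj) hb
  rintro s' ⟨j, b, hj, hbj, heq, hne, rfl⟩
  have h0 : ∀ φ : Flat (ZMod p), φ ∈ row.2.2.1 → φ.b0 φ.j = 0 := fun φ hφ => (hflats' φ hφ).2.1
  rcases rational_or_onFlat_or_onILeaf f (hcov' j hj) h0 hbj heq with
    ⟨b₀, hb₀j, rfl⟩ | ⟨φ, hφ, hφj, hon⟩ | ⟨ℓ, hℓ, hℓj, hon⟩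
  · -- a rational reply
    rcases hall' j hj b₀ hb₀j with h | ⟨φ, hφ, hφj, honB⟩ | ⟨ℓ, hℓ, hℓj, honB⟩
    · have heq₀ : IsEquimultiplePoint p row.1.2.1 j b₀ row.1.1.toState :=
        (BaseChange.isEquimultiplePoint_map_ringHom_iff f p row.1.2.1 j b₀ row.1.1.toState).mp heq
      have hstep := BaseChange.step_map f p row.1.2.1 j b₀ row.1.1.toState
      unfold ireplyOK at h
      rw [Bool.or_eq_true, Bool.or_eq_true] at h
      rcases h with (h1 | h2) | h3
      · rw [Bool.not_eq_true', ← Bool.not_eq_true] at h1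
        exact absurd ((isEquimultiplePoint_iff p row.1.2.1 j b₀ row.1.1).mp heq₀) h1
      · exfalso
        apply hne
        show (step p row.1.2.1 j (f ∘ b₀) (lrowState f row)).F = 0
        rw [lrowState, hstep]
        show MvPolynomial.map f (step p row.1.2.1 j b₀ row.1.1.toState).F = 0
        have hz : (step p row.1.2.1 j b₀ row.1.1.toState).F = 0 := by
          by_contra hnz
          have := (step_F_ne_zero_iff p row.1.2.1 j b₀ row.1.1).mp hnz
          rw [h2] at this
          exact Bool.noConfusion this
        rw [hz, map_zero]
      · obtain ⟨r, hr, hrc⟩ := exists_of_ichildIn h3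
        obtain ⟨ur, hur, rfl⟩ := List.mem_map.mp hr
        show InScopeStateWins p (step p row.1.2.1 j (f ∘ b₀) (lrowState f row))
        rw [lrowState, hstep, step_toState, hrc]
        exact (hrest ur hur).1
    · exact hflat j φ hφ hφj _ (onFlat_of_onFlatB f honB)
    · exact hleaf j ℓ hℓ hℓj _ (by rw [Function.comp_apply, hb₀j, map_zero]) (onLeaf_of_onLeafBL f honB)
  · exact hflat j φ hφ hφj b hon
  · exact hleaf j ℓ hℓ hℓj b hbj hon

/-- **SOUNDNESS of one row over `K`.** [folklore] -/
theorem lrowGood_of_lrowOK {p : ℕ} [Fact p.Prime] {K : Type} [Field K] [CharP K p] [DecidableEq K]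
    (f : ZMod p →+* K) {leafOK : SData 4 (ZMod p) → Finset (Fin 4) → ILeaf (ZMod p) C → Bool}
    (hs : LeafSound p leafOK) {rest : LCert (ZMod p) C} (hrest : ∀ r ∈ rest, LRowGood f r) {row : LRow (ZMod p) C}
    (h : lrowOKL p p leafOK rest row = true) : LRowGood f row := by
  classical
  unfold lrowOKL at h
  rw [Bool.or_eq_true, Bool.or_eq_true] at h
  have hmove : permB p row.1.2.1 row.1.1.L = true →
      lrepliesOKB p rest row.1.1 row.1.2.1 row.2.2.1 row.2.2.2 = true →
      lflatsOKB p rest row.1.1 row.1.2.1 row.2.2.1 = true →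
      lleavesOKB leafOK row.1.1 row.1.2.1 row.2.2.2 = true →
      lcoversOKB p p row.1.1 row.1.2.1 row.2.1 row.2.2.1 row.2.2.2 = true →
      IsPermissibleCentre p row.1.2.1 (lrowState f row).F ∧
        ∀ t, Edge p row.1.2.1 (lrowState f row) t → InScopeStateWins p t := by
    intro hS hall hflats hleaves hcov
    have hperm : IsPermissibleCentre p row.1.2.1 row.1.1.toState.F :=
      (isPermissibleCentre_iff p row.1.2.1 row.1.1.L).mpr hS
    exact ⟨(BaseChange.isPermissibleCentre_map_iff f p row.1.2.1 _).mpr hperm,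
      ledges_of_move f hs hrest hall hflats hleaves hcov⟩
  rcases h with (hb | ht) | hm
  · -- a monomial-curve blindness certificate: blind over `K`; the second clause is vacuous
    have hsome : row.1.2.2 ≠ none := by
      unfold lmonoBlindOK at hb
      obtain ⟨⟨s, S, oβ⟩, ws, fl, lv⟩ := row
      rcases oβ with _ | ⟨c, w, α₀, a⟩ | ⟨P, v, D, kk, α₀, a⟩
      · exact absurd hb Bool.false_ne_true
      · exact Option.some_ne_none _
      · exact Option.some_ne_none _
    refine ⟨?_, fun hnone => absurd hnone hsome⟩
    unfold lmonoBlindOK at hb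
    obtain ⟨⟨s, S, oβ⟩, ws, fl, lv⟩ := row
    rcases oβ with _ | ⟨c, w, α₀, a⟩ | ⟨P, v, D, kk, α₀, a⟩
    · exact absurd hb Bool.false_ne_true
    · exact inScopeStateWins_of_not_inCoordinateScope (not_inCoordinateScope_map_of_blindB f hb)
    · exact absurd hb Bool.false_ne_true
  · -- origin not `p`-fold; the second clause is vacuous
    rw [Bool.not_eq_true'] at ht
    constructor
    · refine inScopeStateWins_of_no_permissible fun S hS => ?_
      exact no_permissible_of_not_permB ht S ((BaseChange.isPermissibleCentre_map_iff f p S _).mp hS)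
    · intro _ huniv
      rw [ht] at huniv
      exact absurd huniv Bool.false_ne_true
  · simp only [Bool.and_eq_true] at hm
    obtain ⟨⟨⟨⟨hS, hall⟩, hflats⟩, hleaves⟩, hcov⟩ := hm
    have hm' := hmove hS hall hflats hleaves hcov
    exact ⟨inScopeStateWins_move row.1.2.1 hm'.1 hm'.2, fun _ _ => hm'⟩

/-! ## 3. Soundness of a certificate over every field of characteristic `p` -/

/-- **SOUNDNESS OVER EVERY FIELD OF CHARACTERISTIC `p`**: every row of a checked certificate is good over `K`.
[folklore] -/
theorem lrowGood_of_lwinCertBL {p : ℕ} [Fact p.Prime] {K : Type} [Field K] [CharP K p] [DecidableEq K]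
    (f : ZMod p →+* K) {leafOK : SData 4 (ZMod p) → Finset (Fin 4) → ILeaf (ZMod p) C → Bool}
    (hs : LeafSound p leafOK) : ∀ {T : LCert (ZMod p) C}, lwinCertBL p p leafOK T = true → ∀ row ∈ T, LRowGood f row
  | [], _ => fun row hrow => absurd hrow List.not_mem_nil
  | row :: rest, h => by
    unfold lwinCertBL at h
    rw [Bool.and_eq_true] at h
    have hrest := lrowGood_of_lwinCertBL f hs h.2
    intro r hr
    rcases List.mem_cons.mp hr with rfl | hr'
    · exact lrowGood_of_lrowOK f hs hrest h.1
    · exact hrest r hr'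

/-- **`∀ K` form**: for a SOUND leaf oracle and every field `K` of characteristic `p`, every row state `⊗ K` of a
checked FCert-v3 certificate is IN-SCOPE ESCAPABLE (`InScopeStateWins p`: the F4-C game at `(p, p)`, player B
ranging over ALL of `K⁴`). [folklore] -/
theorem forall_inScopeStateWins_of_lwinCertBL {p : ℕ} [Fact p.Prime]
    {leafOK : SData 4 (ZMod p) → Finset (Fin 4) → ILeaf (ZMod p) C → Bool} (hs : LeafSound p leafOK)
    {T : LCert (ZMod p) C} (h : lwinCertBL p p leafOK T = true) (K : Type) [Field K] [CharP K p] [DecidableEq K] :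
    ∀ row ∈ T, InScopeStateWins p
      (⟨MvPolynomial.map (ZMod.castHom (dvd_refl p) K) row.1.1.toState.F, row.1.1.toState.r,
        row.1.1.toState.exc⟩ : State K) :=
  fun row hrow => (lrowGood_of_lwinCertBL (ZMod.castHom (dvd_refl p) K) hs h row hrow).1

end WinCertLeaf

end Summit.ResolutionOfSingularities.ResolutionOfSingularities.Theorems.PIDim4

end
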